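import Mathlib.GroupTheory.PushoutI
import Mathlib.Tactic.Group
import HarnessLib

/-!
# Reduced words in an amalgamated free product: uniqueness of the syllable pattern

Topic `Literature/GroupTheory/CombinatorialGroupTheory`; theorems only, over Mathlib's amalgamated
product `Monoid.PushoutI φ` of a family of groups `G i` along injections `φ i : H →* G i`
(Lyndon–Schupp, *Combinatorial Group Theory*, Ch. IV §2; Magnus–Karrass–Solitar §4.2; Serre,
*Trees*, I §1.2–1.3).  We work with *letter lists* `l : List (Σ i, G i)`; such a list is a
**reduced word** when consecutive letters lie in different factors (`l.IsChain (·.1 ≠ ·.1)`) and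
no letter lies in the amalgamated subgroup (`∀ x ∈ l, x.2 ∉ (φ x.1).range`); its value is the
product `ℓπ[φ] l` of its letters in `PushoutI φ` (local notation, no definitions).

* `eq_nil_of_lprod_mem_range` — **the reduced word theorem** (from Mathlib's
  `Monoid.PushoutI.Reduced.eq_empty_of_mem_range`): a reduced word with value in the base group
  is empty; `lprod_ne_one`.
* `map_fst_eq_of_lprod_eq` — **uniqueness of the syllable pattern**: two reduced words whose
  values differ by a left factor from the base group have the same sequence of factors (L–S IV
  Thm. 2.6; via Mathlib's normal words `Monoid.PushoutI.NormalWord`).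
* `inv_mul_mem_range_of_lprod_cons_eq` — the *first-letter lemma*: if `a u` and `b u'` are reduced
  words with the same value and `a, b ∈ G i`, then `b⁻¹ a ∈ φ i(H)`; `lprod_cons_ne_of_ne` — their
  first letters cannot lie in different factors.
* `exists_reduced_eq` — every element is `(base c) · ℓπ[φ] l` for a reduced word `l`.
* `lprod_flatten_replicate`, `pow_lprod_ne_one` — powers of a *cyclically reduced* word (first and
  last letter in different factors) are reduced words, hence non-trivial (MKS Thm. 4.6 proof).

## References

* R. C. Lyndon, P. E. Schupp, *Combinatorial Group Theory*, Springer (1977); Classics in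
  Mathematics (2001), Ch. IV §2 (Thm. 2.6 and the remarks following it). [LyndonSchupp2001]
* J.-P. Serre, *Trees*, Springer (1980), Ch. I §1. [SerreTrees1980]
-/

namespace Literature.GroupTheory.CombinatorialGroupTheory

namespace Amalgam

open Monoid Monoid.PushoutI

variable {ι : Type*} {G : ι → Type*} [∀ i, Group (G i)] {H : Type*} [Group H]
  {φ : ∀ i, H →* G i}

/-- The value in `PushoutI φ` of a letter list. -/
local notation3 "ℓπ[" φ "] " l:max =>
  List.prod (List.map (fun x => Monoid.PushoutI.of (φ := φ) (Sigma.fst x) (Sigma.snd x)) l)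

/-- The formal inverse of a letter list: reverse it and invert every letter. -/
local notation3 "ℓinv " l:max =>
  List.reverse (List.map (fun x => Sigma.mk (Sigma.fst x) (Sigma.snd x)⁻¹) l)

/-! ### The product of a letter list -/

/-- `ℓπ [] = 1`. [cite: LyndonSchupp2001, Ch. IV §2] -/
theorem lprod_nil : ℓπ[φ] ([] : List (Σ i, G i)) = 1 := by simp

/-- `ℓπ (a :: l) = a · ℓπ l`. [cite: LyndonSchupp2001, Ch. IV §2] -/
theorem lprod_cons (a : Σ i, G i) (l : List (Σ i, G i)) :
    ℓπ[φ] (a :: l) = of a.1 a.2 * ℓπ[φ] l := by simp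

/-- `ℓπ (l ++ l') = ℓπ l · ℓπ l'`. [cite: LyndonSchupp2001, Ch. IV §2] -/
theorem lprod_append (l l' : List (Σ i, G i)) : ℓπ[φ] (l ++ l') = ℓπ[φ] l * ℓπ[φ] l' := by
  simp [List.map_append, List.prod_append]

/-- `ℓπ [a] = a`. [cite: LyndonSchupp2001, Ch. IV §2] -/
theorem lprod_singleton (a : Σ i, G i) : ℓπ[φ] [a] = of a.1 a.2 := by simp

/-- `ℓπ (l⁻¹) = (ℓπ l)⁻¹` for the formal inverse. [cite: LyndonSchupp2001, Ch. IV §2] -/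
theorem lprod_inv (l : List (Σ i, G i)) : ℓπ[φ] (ℓinv l) = (ℓπ[φ] l)⁻¹ := by
  simp only [List.prod_inv_reverse, List.map_reverse, List.map_map, Function.comp_def, map_inv]

/-- The formal inverse is an involution. [cite: LyndonSchupp2001, Ch. IV §2] -/
theorem inv_inv_list (l : List (Σ i, G i)) : ℓinv (ℓinv l) = l := by
  induction l with
  | nil => simp
  | cons a l ih =>
    simp only [List.map_cons, List.reverse_cons, List.map_append, List.reverse_append, inv_inv,
      Sigma.eta]
    exact congrArg _ ih

/-- The factors of the formal inverse are those of the word, reversed. [cite: LyndonSchupp2001, Ch. IV §2] -/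
theorem map_fst_inv (l : List (Σ i, G i)) :
    List.map Sigma.fst (ℓinv l) = (l.map Sigma.fst).reverse := by
  rw [List.map_reverse, List.map_map]; rfl

/-- A reversed list alternates iff the list does. [cite: LyndonSchupp2001, Ch. IV §2] -/
theorem isChain_inv_iff (l : List (Σ i, G i)) :
    List.IsChain (fun a b => a.1 ≠ b.1) (ℓinv l) ↔ List.IsChain (fun a b => a.1 ≠ b.1) l := by
  have key : ∀ l : List (Σ i, G i), List.IsChain (fun a b => a.1 ≠ b.1) l ↔
      List.IsChain (fun i j : ι => i ≠ j) (l.map Sigma.fst) := fun l => by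
    rw [List.isChain_map]
  rw [key, key, map_fst_inv, List.isChain_reverse]
  constructor <;> exact List.IsChain.imp fun _ _ h => Ne.symm h

/-- The letters of the formal inverse avoid the base group iff those of the word do.
[cite: LyndonSchupp2001, Ch. IV §2] -/
theorem offBase_inv_iff (l : List (Σ i, G i)) :
    (∀ x ∈ ℓinv l, x.2 ∉ (φ x.1).range) ↔ ∀ x ∈ l, x.2 ∉ (φ x.1).range := by
  simp only [List.mem_reverse, List.mem_map, forall_exists_index, and_imp]
  constructor
  · intro h x hx
    have := h ⟨x.1, x.2⁻¹⟩ x hx rfl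
    simpa using this
  · rintro h _ x hx rfl
    simpa using h x hx

/-! ### The reduced word theorem -/

/-- The value of a letter list is the image of the corresponding element of the free product.
[cite: LyndonSchupp2001, Ch. IV §2] -/
theorem ofCoprodI_prod_eq (w : CoprodI.Word G) : ofCoprodI (φ := φ) w.prod = ℓπ[φ] w.toList := by
  rw [CoprodI.Word.prod, map_list_prod, List.map_map]
  rfl

/-- **The reduced word theorem**: a reduced word whose value lies in the base group `H` is empty.
[cite: LyndonSchupp2001, Ch. IV Thm. 2.6] -/
theorem eq_nil_of_lprod_mem_range (hφ : ∀ i, Function.Injective (φ i)) {l : List (Σ i, G i)}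
    (hc : l.IsChain fun a b => a.1 ≠ b.1) (hr : ∀ x ∈ l, x.2 ∉ (φ x.1).range)
    (h : ℓπ[φ] l ∈ (base φ).range) : l = [] := by
  classical
  let w : CoprodI.Word G := ⟨l, fun x hx h1 => hr x hx (h1 ▸ one_mem _), hc⟩
  have hw : Reduced φ w := fun x hx => hr x hx
  have := hw.eq_empty_of_mem_range hφ (by rwa [ofCoprodI_prod_eq])
  exact congrArg CoprodI.Word.toList this

/-- A non-empty reduced word has non-trivial value. [cite: LyndonSchupp2001, Ch. IV Thm. 2.6] -/
theorem lprod_ne_one (hφ : ∀ i, Function.Injective (φ i)) {l : List (Σ i, G i)}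
    (hc : l.IsChain fun a b => a.1 ≠ b.1) (hr : ∀ x ∈ l, x.2 ∉ (φ x.1).range) (hl : l ≠ []) :
    ℓπ[φ] l ≠ 1 :=
  fun h => hl (eq_nil_of_lprod_mem_range hφ hc hr (h ▸ one_mem _))

/-- A non-empty reduced word does not take its value in the base group.
[cite: LyndonSchupp2001, Ch. IV Thm. 2.6] -/
theorem lprod_ne_base (hφ : ∀ i, Function.Injective (φ i)) {l : List (Σ i, G i)}
    (hc : l.IsChain fun a b => a.1 ≠ b.1) (hr : ∀ x ∈ l, x.2 ∉ (φ x.1).range) (hl : l ≠ [])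
    (c : H) : ℓπ[φ] l ≠ base φ c :=
  fun h => hl (eq_nil_of_lprod_mem_range hφ hc hr (h ▸ ⟨c, rfl⟩))

/-! ### The first-letter lemma -/

/-- Absorbing a base element into the first letter. [cite: LyndonSchupp2001, Ch. IV §2] -/
theorem base_mul_lprod_cons (c : H) (i : ι) (a : G i) (u : List (Σ i, G i)) :
    base φ c * ℓπ[φ] (⟨i, a⟩ :: u) = ℓπ[φ] (⟨i, φ i c * a⟩ :: u) := by
  rw [lprod_cons, lprod_cons, map_mul, of_apply_eq_base, mul_assoc]

/-- Absorbing a base element into the last letter. [cite: LyndonSchupp2001, Ch. IV §2] -/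
theorem lprod_concat_mul_base (c : H) (i : ι) (a : G i) (u : List (Σ i, G i)) :
    ℓπ[φ] (u ++ [⟨i, a⟩]) * base φ c = ℓπ[φ] (u ++ [⟨i, a * φ i c⟩]) := by
  rw [lprod_append, lprod_append, lprod_singleton, lprod_singleton, map_mul, of_apply_eq_base,
    mul_assoc]

/-- A letter outside the base group stays outside after multiplication by base elements.
[cite: LyndonSchupp2001, Ch. IV §2] -/
theorem mul_not_mem_range {i : ι} {a : G i} (ha : a ∉ (φ i).range) (c c' : H) :
    φ i c * a * φ i c' ∉ (φ i).range := by
  intro h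
  apply ha
  have h1 : (φ i c)⁻¹ * (φ i c * a * φ i c') * (φ i c')⁻¹ ∈ (φ i).range :=
    mul_mem (mul_mem (inv_mem ⟨c, rfl⟩) h) (inv_mem ⟨c', rfl⟩)
  have e : (φ i c)⁻¹ * (φ i c * a * φ i c') * (φ i c')⁻¹ = a := by group
  rwa [e] at h1

/-- Left multiples by base elements of a letter outside the base group stay outside.
[cite: LyndonSchupp2001, Ch. IV §2] -/
theorem base_mul_not_mem_range {i : ι} {a : G i} (ha : a ∉ (φ i).range) (c : H) :
    φ i c * a ∉ (φ i).range := by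
  simpa using mul_not_mem_range ha c 1

/-- The inverse of a letter outside the base group is outside the base group.
[cite: LyndonSchupp2001, Ch. IV §2] -/
theorem inv_not_mem_range {i : ι} {a : G i} (ha : a ∉ (φ i).range) : a⁻¹ ∉ (φ i).range :=
  fun h => ha (by simpa using inv_mem h)

/-- **First-letter lemma, different factors**: two reduced words whose first letters lie in
different factors cannot have values differing by a base element.
[cite: LyndonSchupp2001, Ch. IV Thm. 2.6] -/
theorem lprod_cons_ne_of_ne (hφ : ∀ i, Function.Injective (φ i)) {i j : ι} (hij : i ≠ j)
    {a : G i} {b : G j} {u u' : List (Σ i, G i)}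
    (hc : (⟨i, a⟩ :: u : List _).IsChain fun a b => a.1 ≠ b.1)
    (hr : ∀ x ∈ (⟨i, a⟩ :: u : List (Σ i, G i)), x.2 ∉ (φ x.1).range)
    (hc' : (⟨j, b⟩ :: u' : List _).IsChain fun a b => a.1 ≠ b.1)
    (hr' : ∀ x ∈ (⟨j, b⟩ :: u' : List (Σ i, G i)), x.2 ∉ (φ x.1).range) (c : H) :
    ℓπ[φ] (⟨i, a⟩ :: u) ≠ base φ c * ℓπ[φ] (⟨j, b⟩ :: u') := by
  intro h
  rw [base_mul_lprod_cons] at h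
  -- the word `u'⁻¹ (φc·b)⁻¹ a u` is reduced with trivial value
  set L : List (Σ i, G i) := ℓinv u' ++ (⟨j, (φ j c * b)⁻¹⟩ :: ⟨i, a⟩ :: u) with hL
  have hb : b ∉ (φ j).range := hr' _ List.mem_cons_self
  have hLc : L.IsChain fun a b => a.1 ≠ b.1 := by
    rw [hL, List.isChain_append, isChain_inv_iff]
    refine ⟨hc'.tail, List.IsChain.cons_cons (Ne.symm hij) hc, ?_⟩
    intro x hx y hy
    rw [List.head?_cons, Option.mem_some_iff] at hy
    subst hy
    rw [List.getLast?_reverse, List.head?_map, Option.mem_def, Option.map_eq_some_iff] at hx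
    obtain ⟨z, hz, rfl⟩ := hx
    have := hc'.rel_head? hz
    exact fun e => this e.symm
  have hLr : ∀ x ∈ L, x.2 ∉ (φ x.1).range := by
    intro x hx
    rw [hL, List.mem_append] at hx
    rcases hx with hx | hx
    · exact (offBase_inv_iff u').2 (fun y hy => hr' y (List.mem_cons_of_mem _ hy)) x hx
    · rcases List.mem_cons.1 hx with rfl | hx
      · exact inv_not_mem_range (base_mul_not_mem_range hb c)
      · exact hr x hx
  have hval : ℓπ[φ] L = 1 := by
    rw [lprod_cons, lprod_cons] at h
    rw [hL, lprod_append, lprod_inv, lprod_cons, lprod_cons]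
    dsimp only at h ⊢
    rw [h, map_inv, inv_mul_cancel_left, inv_mul_cancel]
  exact lprod_ne_one hφ hLc hLr (by simp [hL]) hval

/-- **First-letter lemma, same factor**: if the reduced words `a u` and `b u'` (with `a, b ∈ G i`)
have values differing by the base element `c` on the left, then `(φ c · b)⁻¹ a ∈ φ i(H)`.
[cite: LyndonSchupp2001, Ch. IV Thm. 2.6] -/
theorem inv_mul_mem_range_of_lprod_cons_eq (hφ : ∀ i, Function.Injective (φ i)) {i : ι}
    {a b : G i} {u u' : List (Σ i, G i)}
    (hc : (⟨i, a⟩ :: u : List _).IsChain fun a b => a.1 ≠ b.1)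
    (hr : ∀ x ∈ (⟨i, a⟩ :: u : List (Σ i, G i)), x.2 ∉ (φ x.1).range)
    (hc' : (⟨i, b⟩ :: u' : List _).IsChain fun a b => a.1 ≠ b.1)
    (hr' : ∀ x ∈ (⟨i, b⟩ :: u' : List (Σ i, G i)), x.2 ∉ (φ x.1).range) (c : H)
    (h : ℓπ[φ] (⟨i, a⟩ :: u) = base φ c * ℓπ[φ] (⟨i, b⟩ :: u')) :
    (φ i c * b)⁻¹ * a ∈ (φ i).range := by
  by_contra hd
  rw [base_mul_lprod_cons] at h
  set L : List (Σ i, G i) := ℓinv u' ++ (⟨i, (φ i c * b)⁻¹ * a⟩ :: u) with hL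
  have hLc : L.IsChain fun a b => a.1 ≠ b.1 := by
    rw [hL, List.isChain_append, isChain_inv_iff]
    refine ⟨hc'.tail, ?_, ?_⟩
    · cases u with
      | nil => exact List.IsChain.singleton _
      | cons y u => exact List.IsChain.cons_cons (hc.rel_head? rfl) hc.tail
    intro x hx y hy
    rw [List.head?_cons, Option.mem_some_iff] at hy
    subst hy
    rw [List.getLast?_reverse, List.head?_map, Option.mem_def, Option.map_eq_some_iff] at hx
    obtain ⟨z, hz, rfl⟩ := hx
    have := hc'.rel_head? hz
    exact fun e => this e.symm
  have hLr : ∀ x ∈ L, x.2 ∉ (φ x.1).range := by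
    intro x hx
    rw [hL, List.mem_append] at hx
    rcases hx with hx | hx
    · exact (offBase_inv_iff u').2 (fun y hy => hr' y (List.mem_cons_of_mem _ hy)) x hx
    · rcases List.mem_cons.1 hx with rfl | hx
      · exact hd
      · exact hr x (List.mem_cons_of_mem _ hx)
  have hval : ℓπ[φ] L = 1 := by
    rw [lprod_cons, lprod_cons] at h
    rw [hL, lprod_append, lprod_inv, lprod_cons]
    dsimp only at h ⊢
    rw [map_mul, map_inv, mul_assoc, h, inv_mul_cancel_left, inv_mul_cancel]
  exact lprod_ne_one hφ hLc hLr (by simp [hL]) hval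

/-! ### Uniqueness of the syllable pattern -/

/-- A letter of a normal word (an element `≠ 1` of the transversal) is not in the base group.
[cite: LyndonSchupp2001, Ch. IV §2] -/
theorem not_mem_range_of_mem_transversal {d : NormalWord.Transversal φ} {i : ι} {g : G i}
    (hg : g ∈ d.set i) (hg1 : g ≠ 1) : g ∉ (φ i).range := by
  intro hgr
  have hinj := (d.compl i).1
  have := @hinj ⟨⟨g, hgr⟩, ⟨1, d.one_mem i⟩⟩ ⟨⟨1, one_mem _⟩, ⟨g, hg⟩⟩ (by simp)
  simp only [Prod.mk.injEq, Subtype.mk.injEq] at this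
  exact hg1 this.1

/-- A normal word is a reduced word. [cite: LyndonSchupp2001, Ch. IV §2] -/
theorem normalWord_offBase {d : NormalWord.Transversal φ} (w : NormalWord d) :
    ∀ x ∈ w.toList, x.2 ∉ (φ x.1).range := fun x hx =>
  not_mem_range_of_mem_transversal (w.normalized x.1 x.2 hx) (w.ne_one x hx)

/-- **Every element is the value of a reduced word, up to a base element on the left**:
`x = (base c) · ℓπ l`. [cite: LyndonSchupp2001, Ch. IV Thm. 2.6] -/
theorem exists_reduced_eq (hφ : ∀ i, Function.Injective (φ i)) (x : PushoutI φ) :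
    ∃ (c : H) (l : List (Σ i, G i)), l.IsChain (fun a b => a.1 ≠ b.1) ∧
      (∀ y ∈ l, y.2 ∉ (φ y.1).range) ∧ x = base φ c * ℓπ[φ] l := by
  classical
  obtain ⟨d⟩ := NormalWord.transversal_nonempty φ hφ
  let w : NormalWord d := NormalWord.equiv x
  refine ⟨w.head, w.toList, w.chain_ne, normalWord_offBase w, ?_⟩
  have hx : w.prod = x := (NormalWord.equiv (d := d)).symm_apply_apply x
  rw [← hx, NormalWord.prod, ofCoprodI_prod_eq]

/-- **Uniqueness of the syllable pattern**: reduced words whose values differ by a base element on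
the left have the same sequence of factors (in particular the same length).
[cite: LyndonSchupp2001, Ch. IV Thm. 2.6] -/
theorem map_fst_eq_of_lprod_eq (hφ : ∀ i, Function.Injective (φ i)) {l l' : List (Σ i, G i)}
    (hc : l.IsChain fun a b => a.1 ≠ b.1) (hr : ∀ x ∈ l, x.2 ∉ (φ x.1).range)
    (hc' : l'.IsChain fun a b => a.1 ≠ b.1) (hr' : ∀ x ∈ l', x.2 ∉ (φ x.1).range) (c : H)
    (h : ℓπ[φ] l = base φ c * ℓπ[φ] l') : l.map Sigma.fst = l'.map Sigma.fst := by
  classical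
  obtain ⟨d⟩ := NormalWord.transversal_nonempty φ hφ
  let w : CoprodI.Word G := ⟨l, fun x hx h1 => hr x hx (h1 ▸ one_mem _), hc⟩
  let w' : CoprodI.Word G := ⟨l', fun x hx h1 => hr' x hx (h1 ▸ one_mem _), hc'⟩
  obtain ⟨n, hn, hnl⟩ := Reduced.exists_normalWord_prod_eq d (w := w) fun x hx => hr x hx
  obtain ⟨n', hn', hnl'⟩ := Reduced.exists_normalWord_prod_eq d (w := w') fun x hx => hr' x hx
  rw [ofCoprodI_prod_eq] at hn hn'
  have hcn : n.prod = (c • n').prod := by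
    rw [NormalWord.prod_base_smul, hn', hn]; exact h
  have heq : n = c • n' := NormalWord.prod_injective hcn
  have e1 : n.toList.map Sigma.fst = l.map Sigma.fst := hnl
  have e2 : n'.toList.map Sigma.fst = l'.map Sigma.fst := hnl'
  rw [← e1, ← e2, heq, NormalWord.base_smul_def']

/-- Corollary: such reduced words have the same length. [cite: LyndonSchupp2001, Ch. IV Thm. 2.6] -/
theorem length_eq_of_lprod_eq (hφ : ∀ i, Function.Injective (φ i)) {l l' : List (Σ i, G i)}
    (hc : l.IsChain fun a b => a.1 ≠ b.1) (hr : ∀ x ∈ l, x.2 ∉ (φ x.1).range)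
    (hc' : l'.IsChain fun a b => a.1 ≠ b.1) (hr' : ∀ x ∈ l', x.2 ∉ (φ x.1).range) (c : H)
    (h : ℓπ[φ] l = base φ c * ℓπ[φ] l') : l.length = l'.length := by
  simpa using congrArg List.length (map_fst_eq_of_lprod_eq hφ hc hr hc' hr' c h)

/-! ### Powers of cyclically reduced words -/

omit [∀ i, Group (G i)] in
/-- A word whose first and last letters lie in different factors can be repeated: the
concatenation of `m` copies still alternates. [cite: LyndonSchupp2001, Ch. IV §2] -/
theorem isChain_flatten_replicate {l : List (Σ i, G i)} (hc : l.IsChain fun a b => a.1 ≠ b.1)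
    (hcr : ∀ x ∈ l.getLast?, ∀ y ∈ l.head?, x.1 ≠ y.1) (m : ℕ) :
    (List.replicate m l).flatten.IsChain fun a b => a.1 ≠ b.1 := by
  induction m with
  | zero => simp
  | succ m ih =>
    rw [List.replicate_succ, List.flatten_cons, List.isChain_append]
    refine ⟨hc, ih, fun x hx y hy => ?_⟩
    cases m with
    | zero => simp at hy
    | succ m =>
      have hl : l ≠ [] := by rintro rfl; simp at hx
      rw [List.replicate_succ, List.flatten_cons, List.head?_append_of_ne_nil _ hl] at hy
      exact hcr x hx y hy

/-- The value of `m` copies of a word is the `m`-th power of its value.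
[cite: LyndonSchupp2001, Ch. IV §2] -/
theorem lprod_flatten_replicate (l : List (Σ i, G i)) (m : ℕ) :
    ℓπ[φ] (List.replicate m l).flatten = (ℓπ[φ] l) ^ m := by
  induction m with
  | zero => simp
  | succ m ih => rw [List.replicate_succ, List.flatten_cons, lprod_append, ih, pow_succ']

/-- **A non-empty cyclically reduced word has infinite order**: `(ℓπ l) ^ m ≠ 1` for `m ≠ 0`.
[cite: LyndonSchupp2001, Ch. IV Thm. 2.6] -/
theorem pow_lprod_ne_one (hφ : ∀ i, Function.Injective (φ i)) {l : List (Σ i, G i)}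
    (hc : l.IsChain fun a b => a.1 ≠ b.1) (hr : ∀ x ∈ l, x.2 ∉ (φ x.1).range)
    (hcr : ∀ x ∈ l.getLast?, ∀ y ∈ l.head?, x.1 ≠ y.1) (hl : l ≠ []) {m : ℕ} (hm : m ≠ 0) :
    (ℓπ[φ] l) ^ m ≠ 1 := by
  rw [← lprod_flatten_replicate]
  refine lprod_ne_one hφ (isChain_flatten_replicate hc hcr m) ?_ ?_
  · intro x hx
    rw [List.mem_flatten] at hx
    obtain ⟨l₁, hl₁, hx⟩ := hx
    rw [List.eq_of_mem_replicate hl₁] at hx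
    exact hr x hx
  · obtain ⟨m, rfl⟩ := Nat.exists_eq_succ_of_ne_zero hm
    simp [List.replicate_succ, hl]

end Amalgam

end Literature.GroupTheory.CombinatorialGroupTheory
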